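import Mathlib.InformationTheory.KullbackLeibler.KLFun
import HarnessLib

/-!
# Route `BECRieszReverseHolder`, crux `CoarseGrainedReverseHolder`
# (stmt-AtomisticToContinuum-12840), line `registered`: stub `stub_sum_klFun_le_mul_log`

Supports (does not close) stmt-AtomisticToContinuum-12840; stub `stub_sum_klFun_le_mul_log` of the
line `registered` (`Cruxes/CoarseGrainedReverseHolder/Lines/registered.lean`).

**Finite-alphabet Jensen (Shannon entropy deficit ≤ Rényi-2 entropy deficit).** For non-negative
weights `A_k` on a finite alphabet of size `K > 0` with `Σ_k A_k = m > 0`,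

`Σ_k (m/K) klFun(K A_k/m) ≤ m · log(K Σ_k A_k² / m²)`,

where `klFun x = x log x + 1 - x` is Mathlib's junk-free Kullback–Leibler integrand. In terms of the
probability vector `p = A/m` this reads `KL(p ‖ uniform) = log K − H(p) ≤ log K − H₂(p)`, i.e. the
Shannon entropy dominates the collision (Rényi-2) entropy `H₂(p) = −log Σ p_k²`.

Proof (elementary, Mathlib only).
* Bookkeeping: termwise `(m/K) klFun(K A_k/m) = A_k log(K A_k/m) + m/K − A_k` (valid also at
  `A_k = 0`), and `Σ_k m/K = m = Σ_k A_k`, so the left side is `Σ_k A_k log(K A_k/m)`.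
* Tangent line of `log` at `t := K Σ_k A_k² / m² > 0`: for `A_k > 0`,
  `log(K A_k/m) = log((K A_k/m)/t) + log t ≤ (K A_k/m)/t − 1 + log t` (`log u ≤ u − 1`); multiply by
  `A_k ≥ 0` (trivial when `A_k = 0`) and sum: `Σ_k A_k log(K A_k/m) ≤ (K/(m t)) Σ_k A_k² − m + m log t
  = m log t`, because `(K/(m t)) Σ_k A_k² = m`.

## References

* H. Delfs, H. Knebl, *Introduction to Cryptography* (Springer, 2002), Prop. 10.11 (`H₂(X) ≤ H(X)`,
  by Jensen for `−log`). [cite: CoverThomas2005, Thm 2.7.1]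
* Mathlib `InformationTheory.klFun_apply`, `Real.log_le_sub_one_of_pos`, `Real.log_div`,
  `Finset.sum_pos_iff_of_nonneg`.
-/

open InformationTheory
open scoped BigOperators

namespace Summit.AtomisticToContinuum.BoseEinsteinCondensation.Theorems.CoarseGrainedReverseHolder

/-- **Finite-alphabet Jensen (Shannon deficit ≤ Rényi-2 deficit).** For non-negative weights `A_k` on an
alphabet of size `K > 0` with `Σ_k A_k = m > 0`:
`Σ_k (m/K) klFun(K A_k/m) ≤ m · log(K Σ_k A_k² / m²)`. Indeed the left side equals
`Σ_k A_k log(K A_k/m) = m Σ_k p_k log(K p_k)` (`p = A/m`, `Σ_k m/K = m = Σ_k A_k`), and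
`Σ_k p_k log(K p_k) ≤ log Σ_k p_k (K p_k)` by concavity of `log` (here: the tangent line
`log u ≤ u/t − 1 + log t` at `t = K Σ p_k²`). [cite: CoverThomas2005, Thm 2.7.1] -/
theorem stub_sum_klFun_le_mul_log {ι : Type*} [Fintype ι] {K m : ℝ}
    (hK : (Fintype.card ι : ℝ) = K) (hKpos : 0 < K) {A : ι → ℝ} (hA : ∀ k, 0 ≤ A k)
    (hsumA : ∑ k, A k = m) (hm : 0 < m) :
    ∑ k, m / K * klFun (K * A k / m) ≤ m * Real.log (K * (∑ k, A k ^ 2) / m ^ 2) := by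
  have hKne : K ≠ 0 := hKpos.ne'
  have hmne : m ≠ 0 := hm.ne'
  -- (i) bookkeeping: the left side is `Σ_k A_k log(K A_k/m)`
  have h1 : ∀ k, m / K * klFun (K * A k / m) = A k * Real.log (K * A k / m) + m / K - A k := by
    intro k
    rw [klFun_apply]
    field_simp
  have hLHS : ∑ k, m / K * klFun (K * A k / m) = ∑ k, A k * Real.log (K * A k / m) := by
    simp only [h1, Finset.sum_sub_distrib, Finset.sum_add_distrib, Finset.sum_const,
      Finset.card_univ, nsmul_eq_mul, hK, hsumA]
    rw [mul_div_cancel₀ _ hKne]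
    ring
  -- (ii) positivity of `Σ_k A_k²` and of the tangent point `t`
  obtain ⟨k₀, -, hk₀⟩ := (Finset.sum_pos_iff_of_nonneg fun k _ => hA k).1
    (show (0 : ℝ) < ∑ k, A k by rw [hsumA]; exact hm)
  have hSpos : 0 < ∑ k, A k ^ 2 :=
    (Finset.sum_pos_iff_of_nonneg fun k _ => sq_nonneg (A k)).2
      ⟨k₀, Finset.mem_univ k₀, pow_pos hk₀ 2⟩
  have hSne : (∑ k, A k ^ 2) ≠ 0 := hSpos.ne'
  generalize ht : K * (∑ k, A k ^ 2) / m ^ 2 = t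
  have htpos : 0 < t := by rw [← ht]; positivity
  -- (iii) termwise tangent-line bound
  have h2 : ∀ k, A k * Real.log (K * A k / m) ≤ A k * (K * A k / m / t - 1 + Real.log t) := by
    intro k
    rcases (hA k).eq_or_lt with hA0 | hApos
    · simp [← hA0]
    · refine mul_le_mul_of_nonneg_left ?_ (hA k)
      have hu : 0 < K * A k / m := by positivity
      have hlog := Real.log_le_sub_one_of_pos (div_pos hu htpos)
      rw [Real.log_div hu.ne' htpos.ne'] at hlog
      linarith
  -- (iv) sum the tangent-line bounds
  have h3 : ∀ k, A k * (K * A k / m / t - 1 + Real.log t) =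
      K / (m * t) * A k ^ 2 - A k + Real.log t * A k := by
    intro k
    field_simp
  calc ∑ k, m / K * klFun (K * A k / m) = ∑ k, A k * Real.log (K * A k / m) := hLHS
    _ ≤ ∑ k, A k * (K * A k / m / t - 1 + Real.log t) := Finset.sum_le_sum fun k _ => h2 k
    _ = m * Real.log t := by
      simp only [h3, Finset.sum_add_distrib, Finset.sum_sub_distrib, ← Finset.mul_sum, hsumA]
      rw [← ht]
      field_simp
      ring

end Summit.AtomisticToContinuum.BoseEinsteinCondensation.Theorems.CoarseGrainedReverseHolder
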